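import Literature.NumberTheory.LFunctions.FordLemma32A
import Literature.NumberTheory.LFunctions.FordVinogradovDiagonal
import Mathlib.RingTheory.MvPolynomial.Symmetric.NewtonIdentities
import Mathlib.Analysis.MeanInequalities
import HarnessLib

/-!
# Ford's Lemma 3.2 (general `d`), part B: the residue classes (`S₃ → S₄`, (3.4))

Topic `Literature/NumberTheory/LFunctions`. Everything here is PROVED.

K. Ford, Proc. LMS 85 (2002), proof of Lemma 3.2, the step
`S₃(p) ≤ d! p^{2s−d} max_c S₄(c,p)` ((3.4)): for a system of type `(d,T)` the equations `j ≤ d`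
force equal power sums of the `x`- and `y`-variables, so their residues mod `p` lie in a common
class `ℬ_s(w)` with `|ℬ_s(w)| ≤ d! p^{s−d}` (Newton's identities over `ℤ/p`, `p > d`); then
Cauchy–Schwarz over the class and the arithmetic–geometric mean inequality.

## References

* K. Ford, Proc. London Math. Soc. (3) 85 (2002), 565–633, proof of Lemma 3.2, (3.4)–(3.5).
  [Ford2002]
-/

noncomputable section

open Finset MeasureTheory Polynomial Complex
open scoped Real ComplexConjugate

namespace Literature.NumberTheory.LFunctions
namespace FordVK

open VMV

/-! ### Newton's identities over a field -/

section Newton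

variable {F : Type*} [Field F]

/-- Power sums as evaluations of `MvPolynomial.psum`. [folklore] -/
theorem aeval_psum_eq_field {K : ℕ} (f : Fin K → F) (n : ℕ) :
    MvPolynomial.aeval f (MvPolynomial.psum (Fin K) F n) = ∑ i, f i ^ n := by
  simp [MvPolynomial.psum, map_sum, map_pow, MvPolynomial.aeval_X]

/-- **Newton** over a field in which `1, …, K` are invertible: equal power sums `p_1,…,p_K` give
equal elementary symmetric functions. [cite: Ford2002, proof of Lemma 3.2 ("By Newton's formulas …")] -/
theorem esymm_eq_of_powerSum_eq_field {K : ℕ} (x y : Fin K → F)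
    (hK : ∀ j : ℕ, 1 ≤ j → j ≤ K → (j : F) ≠ 0)
    (h : ∀ j, 1 ≤ j → j ≤ K → ∑ i, x i ^ j = ∑ i, y i ^ j) :
    ∀ j, j ≤ K → (univ.val.map x).esymm j = (univ.val.map y).esymm j := by
  intro j
  induction j using Nat.strong_induction_on with
  | _ j ih =>
    intro hjK
    rcases Nat.eq_zero_or_pos j with hj0 | hjpos
    · subst hj0
      simp [Multiset.esymm, Multiset.powersetCard_zero_left]
    have newton := MvPolynomial.mul_esymm_eq_sum (Fin K) F j
    have hx := congrArg (MvPolynomial.aeval x) newton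
    have hy := congrArg (MvPolynomial.aeval y) newton
    simp only [map_mul, map_natCast, map_pow, map_neg, map_one, map_sum,
      MvPolynomial.aeval_esymm_eq_multiset_esymm, aeval_psum_eq_field] at hx hy
    have hsum : ∑ a ∈ (antidiagonal j).filter (fun a => a.1 < j),
          (-1 : F) ^ a.1 * (univ.val.map x).esymm a.1 * ∑ i, x i ^ a.2
        = ∑ a ∈ (antidiagonal j).filter (fun a => a.1 < j),
          (-1 : F) ^ a.1 * (univ.val.map y).esymm a.1 * ∑ i, y i ^ a.2 := by
      refine Finset.sum_congr rfl fun a ha => ?_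
      rw [Finset.mem_filter, Finset.HasAntidiagonal.mem_antidiagonal] at ha
      rw [ih a.1 ha.2 (by omega), h a.2 (by omega) (by omega)]
    have hj : (j : F) ≠ 0 := hK j hjpos hjK
    have := hx.trans (hsum ▸ hy.symm)
    exact mul_left_cancel₀ hj this

/-- Equal power sums force equal multisets of values. [folklore] -/
theorem multiset_eq_of_powerSum_eq_field [DecidableEq F] {K : ℕ} (x y : Fin K → F)
    (hK : ∀ j : ℕ, 1 ≤ j → j ≤ K → (j : F) ≠ 0)
    (h : ∀ j, 1 ≤ j → j ≤ K → ∑ i, x i ^ j = ∑ i, y i ^ j) :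
    univ.val.map x = univ.val.map y := by
  have he := esymm_eq_of_powerSum_eq_field x y hK h
  have hcx : Multiset.card (univ.val.map x) = K := by simp
  have hcy : Multiset.card (univ.val.map y) = K := by simp
  have hprod : ((univ.val.map x).map fun t => Polynomial.X - Polynomial.C t).prod
      = ((univ.val.map y).map fun t => Polynomial.X - Polynomial.C t).prod := by
    rw [Multiset.prod_X_sub_X_eq_sum_esymm, Multiset.prod_X_sub_X_eq_sum_esymm, hcx, hcy]
    refine Finset.sum_congr rfl fun j hj => ?_
    rw [Finset.mem_range] at hj
    rw [he j (by omega)]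
  have := congrArg Polynomial.roots hprod
  rwa [Polynomial.roots_multiset_prod_X_sub_C, Polynomial.roots_multiset_prod_X_sub_C] at this

end Newton

/-! ### Residue tuples with prescribed power sums: `|ℬ_d(v)| ≤ d!` and `|ℬ_s(w)| ≤ d! p^{s−d}` -/

section Residues

variable {p : ℕ} [hp : Fact p.Prime]

/-- Two tuples of residues in `[0,p)` (`p > d` prime) with the same power sums `1,…,d` modulo `p` are
permutations of each other. [cite: Ford2002, proof of Lemma 3.2 ("Thus c' is a permutation of c")] -/
theorem exists_perm_of_powerSum_modEq {d : ℕ} (hdp : d < p) {c c' : Fin d → ℤ}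
    (hc : ∀ i, c i ∈ Finset.Ico (0 : ℤ) p) (hc' : ∀ i, c' i ∈ Finset.Ico (0 : ℤ) p)
    (h : ∀ j, 1 ≤ j → j ≤ d → (∑ i, c i ^ j : ℤ) ≡ ∑ i, c' i ^ j [ZMOD p]) :
    ∃ σ : Equiv.Perm (Fin d), c' = c ∘ σ := by
  classical
  -- pass to `ZMod p`
  set x : Fin d → ZMod p := fun i => (c i : ZMod p) with hx
  set y : Fin d → ZMod p := fun i => (c' i : ZMod p) with hy
  have hK : ∀ j : ℕ, 1 ≤ j → j ≤ d → (j : ZMod p) ≠ 0 := by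
    intro j hj1 hjd h0
    rw [ZMod.natCast_eq_zero_iff] at h0
    have := Nat.le_of_dvd (by omega) h0; omega
  have hsum : ∀ j, 1 ≤ j → j ≤ d → ∑ i, x i ^ j = ∑ i, y i ^ j := by
    intro j hj1 hjd
    have := (ZMod.intCast_eq_intCast_iff _ _ _).2 (h j hj1 hjd)
    push_cast at this
    simpa [hx, hy] using this
  have hm := multiset_eq_of_powerSum_eq_field x y hK hsum
  -- back to `ℤ` via `ZMod.val`
  have hval : ∀ z : ℤ, z ∈ Finset.Ico (0 : ℤ) p → (((z : ZMod p).val : ℕ) : ℤ) = z := by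
    intro z hz
    rw [Finset.mem_Ico] at hz
    rw [ZMod.val_intCast, Int.emod_eq_of_lt hz.1 hz.2]
  have hcm : univ.val.map c = (univ.val.map x).map (fun t : ZMod p => ((t.val : ℕ) : ℤ)) := by
    rw [Multiset.map_map]; congr 1; funext i; simp only [Function.comp, hx]; rw [hval _ (hc i)]
  have hcm' : univ.val.map c' = (univ.val.map y).map (fun t : ZMod p => ((t.val : ℕ) : ℤ)) := by
    rw [Multiset.map_map]; congr 1; funext i; simp only [Function.comp, hy]; rw [hval _ (hc' i)]
  have hmz : univ.val.map c = univ.val.map c' := by rw [hcm, hcm', hm]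
  obtain ⟨σ, hσ⟩ := exists_perm_of_multiset_eq hmz.symm
  exact ⟨σ, hσ⟩

/-- **`|ℬ_d(v)| ≤ d!`**: residue `d`-tuples with prescribed power sums `1,…,d` mod `p`.
[cite: Ford2002, proof of Lemma 3.2 ("whence |ℬ_d(v)| ≤ d!")] -/
theorem card_head_class_le {d : ℕ} (hdp : d < p) (S : Finset (Fin d → ℤ))
    (hS : ∀ c ∈ S, ∀ i, c i ∈ Finset.Ico (0 : ℤ) p)
    (hpow : ∀ c ∈ S, ∀ c' ∈ S, ∀ j, 1 ≤ j → j ≤ d → (∑ i, c i ^ j : ℤ) ≡ ∑ i, c' i ^ j [ZMOD p]) :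
    S.card ≤ d.factorial := by
  classical
  rcases S.eq_empty_or_nonempty with hS0 | ⟨c₀, hc₀⟩
  · rw [hS0]; simp
  calc S.card ≤ ((univ : Finset (Equiv.Perm (Fin d))).image fun σ : Equiv.Perm (Fin d) => c₀ ∘ ⇑σ).card := by
        refine card_le_card fun c hc => ?_
        obtain ⟨σ, hσ⟩ := exists_perm_of_powerSum_modEq hdp (hS c₀ hc₀) (hS c hc) (hpow c₀ hc₀ c hc)
        exact mem_image.2 ⟨σ, mem_univ _, hσ.symm⟩
    _ ≤ (univ : Finset (Equiv.Perm (Fin d))).card := card_image_le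
    _ = d.factorial := by rw [card_univ, Fintype.card_perm, Fintype.card_fin]

/-- The class `ℬ(w)` of residue `(d+e)`-tuples whose first `d` power sums are `≡ w (mod p)`.
[cite: Ford2002, proof of Lemma 3.2 (`ℬ_s(w)`)] -/
def Bclass (p d e : ℕ) (w : Fin d → ℤ) : Finset (Fin (d + e) → ℤ) :=
  (tuples (d + e) (Finset.Ico (0 : ℤ) p)).filter fun c => ∀ j : Fin d, (∑ i, c i ^ (j.val + 1) : ℤ) ≡ w j [ZMOD p]

omit hp in
/-- Auxiliary step (elementary consequence of the standing hypotheses). [folklore] -/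
theorem mem_Bclass {d e : ℕ} {w : Fin d → ℤ} {c : Fin (d + e) → ℤ} :
    c ∈ Bclass p d e w ↔ (∀ i, c i ∈ Finset.Ico (0 : ℤ) p) ∧ ∀ j : Fin d, (∑ i, c i ^ (j.val + 1) : ℤ) ≡ w j [ZMOD p] := by
  rw [Bclass, mem_filter, mem_tuples]

/-- **`|ℬ_s(w)| ≤ d! p^{s−d}`** (`s = d + e`). [cite: Ford2002, proof of Lemma 3.2 ("|ℬ_s(w)| ≤ d! p^{s−d}")] -/
theorem card_Bclass_le {d e : ℕ} (hdp : d < p) (w : Fin d → ℤ) :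
    (Bclass p d e w).card ≤ d.factorial * p ^ e := by
  classical
  -- fibre over the tail
  set tail : (Fin (d + e) → ℤ) → (Fin e → ℤ) := fun c i => c (Fin.natAdd d i) with htail
  set head : (Fin (d + e) → ℤ) → (Fin d → ℤ) := fun c i => c (Fin.castAdd e i) with hhead
  have hfib : ∀ t ∈ tuples e (Finset.Ico (0 : ℤ) p), ((Bclass p d e w).filter fun c => tail c = t).card ≤ d.factorial := by
    intro t _
    -- the heads of the fibre form a class with constant power sums
    have hinj : Set.InjOn head ↑((Bclass p d e w).filter fun c => tail c = t) := by
      intro c hc c' hc' hh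
      rw [mem_coe, mem_filter] at hc hc'
      funext i
      refine Fin.addCases (fun i => ?_) (fun i => ?_) i
      · exact congrFun hh i
      · have h1 := congrFun hc.2 i; have h2 := congrFun hc'.2 i
        simp only [htail] at h1 h2; rw [h1, h2]
    rw [← card_image_of_injOn hinj]
    refine card_head_class_le hdp _ ?_ ?_
    · intro h hh i
      rw [mem_image] at hh; obtain ⟨c, hc, rfl⟩ := hh
      rw [mem_filter, mem_Bclass] at hc
      exact hc.1.1 _
    · intro h hh h' hh' j hj1 hjd
      rw [mem_image] at hh hh'
      obtain ⟨c, hc, rfl⟩ := hh; obtain ⟨c', hc', rfl⟩ := hh'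
      rw [mem_filter, mem_Bclass] at hc hc'
      have e1 : ∀ c : Fin (d + e) → ℤ, (∑ i, c i ^ j : ℤ) = ∑ i, head c i ^ j + ∑ i, tail c i ^ j := by
        intro c; rw [Fin.sum_univ_add]
      have k1 := hc.1.2 ⟨j - 1, by omega⟩
      have k2 := hc'.1.2 ⟨j - 1, by omega⟩
      simp only [show j - 1 + 1 = j by omega] at k1 k2
      rw [e1] at k1 k2
      rw [hc.2] at k1; rw [hc'.2] at k2
      have := k1.trans k2.symm
      exact (Int.ModEq.add_right_cancel' _ this)
  calc (Bclass p d e w).card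
      = ∑ t ∈ tuples e (Finset.Ico (0 : ℤ) p), ((Bclass p d e w).filter fun c => tail c = t).card := by
        refine card_eq_sum_card_fiberwise fun c hc => ?_
        rw [mem_coe, mem_Bclass] at hc
        rw [mem_coe, mem_tuples]; intro i; exact hc.1 _
    _ ≤ ∑ t ∈ tuples e (Finset.Ico (0 : ℤ) p), d.factorial := sum_le_sum hfib
    _ = d.factorial * p ^ e := by
        rw [sum_const, card_tuples, smul_eq_mul, mul_comm]
        congr 2; simp

end Residues

/-! ### Step D: `S₃(p) ≤ d! p^{2s−d} max_c S₄(c,p)` -/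

/-- AM–GM: `∏_{i<s} a_i ≤ (∑ a_i^s)/s` for nonnegative reals, `s ≥ 1`. [folklore] -/
theorem prod_le_sum_pow_div {s : ℕ} (hs : 1 ≤ s) (a : Fin s → ℝ) (ha : ∀ i, 0 ≤ a i) :
    ∏ i, a i ≤ (∑ i, a i ^ s) / s := by
  have hs0 : (s : ℝ) ≠ 0 := by have : (1:ℝ) ≤ s := by exact_mod_cast hs
                               linarith
  have hs0' : s ≠ 0 := by omega
  have hAMGM := Real.geom_mean_le_arith_mean_weighted (univ : Finset (Fin s))
    (fun _ => 1 / (s : ℝ)) (fun i => a i ^ s) (fun _ _ => by positivity)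
    (by rw [sum_const, card_univ, Fintype.card_fin, nsmul_eq_mul]; field_simp)
    (fun i _ => pow_nonneg (ha i) _)
  have hL : ∏ i, (a i ^ s) ^ (1 / (s : ℝ)) = ∏ i, a i := by
    refine prod_congr rfl fun i _ => ?_
    rw [one_div, Real.pow_rpow_inv_natCast (ha i) hs0']
  rw [hL] at hAMGM
  refine hAMGM.trans (le_of_eq ?_)
  rw [Finset.sum_div]
  refine sum_congr rfl fun i _ => ?_
  ring

section StepD

variable {k : ℕ}

/-- `Z̃ = {z ∈ [1,P]^k : p ∤ J_n(z|ₙ;Ψ)}`. [cite: Ford2002, proof of Lemma 3.2 (the sum `F̃(α)`)] -/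
def Zt (P : ℕ) (Ψ : PSystem k) (d n : ℕ) (hnd : n + d ≤ k) (p : ℕ) : Finset (Fin k → ℤ) :=
  (tuples k (Finset.Icc 1 (P : ℤ))).filter fun z => ¬ ((p : ℤ) ∣ jac Ψ d n hnd (headN (by omega) z))

/-- The residue class `{x ∈ [1,Q] : x ≡ c (mod p)}`. [cite: Ford2002, proof of Lemma 3.2 (the sum `g(α;b)`)] -/
def Xc (Q : ℕ) (p : ℕ) (c : ℤ) : Finset ℤ := (Finset.Icc 1 (Q : ℤ)).filter fun x => (p : ℤ) ∣ x - c

/-- Tuples with prescribed residues: `∏_i Xc (c i)`. [folklore] -/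
def Xvec (Q s : ℕ) (p : ℕ) (c : Fin s → ℤ) : Finset (Fin s → ℤ) := Fintype.piFinset fun i => Xc Q p (c i)

/-- **`S₄(c,p)`**: solutions with `z, w ∈ Z̃` and all `x_i, y_i ≡ c (mod p)`. [cite: Ford2002, (3.5)] -/
def S4 (s P Q : ℕ) (Ψ : PSystem k) (q : ℤ) (d n : ℕ) (hnd : n + d ≤ k) (p : ℕ) (c : ℤ) : ℕ :=
  (((Zt P Ψ d n hnd p ×ˢ tuples s (Xc Q p c)) ×ˢ (Zt P Ψ d n hnd p ×ˢ tuples s (Xc Q p c))).filter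
    fun a => Kfreq Ψ q a.1 = Kfreq Ψ q a.2).card

variable (s P Q : ℕ) (Ψ : PSystem k) (q : ℤ) (d n : ℕ) (hnd : n + d ≤ k) (p : ℕ)

/-- `|F̃(α)|`. [cite: Ford2002, proof of Lemma 3.2] -/
def absFt (α : Fin k → ℝ) : ℝ := ‖tp (Zt P Ψ d n hnd p) (tupSum (sysv Ψ)) α‖
/-- `|g(α;c)|`. [cite: Ford2002, proof of Lemma 3.2] -/
def absg (c : ℤ) (α : Fin k → ℝ) : ℝ := ‖tp (Xc Q p c) (powv k q) α‖

/-- **`S₄(c,p) = ∫ |F̃|² |g(·;c)|^{2s}`.** [cite: Ford2002, proof of Lemma 3.2 ("S₄(c,p) = ∫ |F̃(α)² g(α;c)^{2s}| dα")] -/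
theorem S4_eq_integral (c : ℤ) :
    (S4 s P Q Ψ q d n hnd p c : ℝ) = ∫ α in box k, absFt P Ψ d n hnd p α ^ 2 * absg Q q p c α ^ (2 * s) := by
  have h := integral_norm_sq_tp (n := k) (Zt P Ψ d n hnd p ×ˢ tuples s (Xc Q p c)) (Kfreq Ψ q)
  rw [S4, ← h]
  refine setIntegral_congr_fun (measurableSet_box k) fun α _ => ?_
  have e : tp (Zt P Ψ d n hnd p ×ˢ tuples s (Xc Q p c)) (Kfreq Ψ q) α
      = tp (Zt P Ψ d n hnd p) (tupSum (sysv Ψ)) α * tp (tuples s (Xc Q p c)) (tupSum (powv k q)) α := by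
    rw [tp_mul]; rfl
  simp only [absFt, absg]
  rw [e, tp_tuples_tupSum, norm_mul, norm_pow, mul_pow, ← pow_mul, mul_comm s 2]

/-- The tagged index set `A_C = Z̃ × {(c, x) : c ∈ C, x ∈ Xvec c}`. [folklore] -/
def AC (C : Finset (Fin s → ℤ)) : Finset ((Fin k → ℤ) × ((Fin s → ℤ) × (Fin s → ℤ))) :=
  Zt P Ψ d n hnd p ×ˢ ((C ×ˢ tuples s (Finset.Icc 1 (Q : ℤ))).filter fun cx => cx.2 ∈ Xvec Q s p cx.1)

/-- The frequency on `A_C` (forget the tag). [folklore] -/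
def vAC (a : (Fin k → ℤ) × ((Fin s → ℤ) × (Fin s → ℤ))) : Fin k → ℤ := Kfreq Ψ q (a.1, a.2.2)

/-- `tp A_C = F̃ · ∑_{c ∈ C} G_c`, `G_c = ∏_i g(·; c_i)`. [folklore] -/
theorem tp_AC (C : Finset (Fin s → ℤ)) (α : Fin k → ℝ) :
    tp (AC s P Q Ψ d n hnd p C) (vAC s Ψ q) α
      = tp (Zt P Ψ d n hnd p) (tupSum (sysv Ψ)) α * ∑ c ∈ C, ∏ i, tp (Xc Q p (c i)) (powv k q) α := by
  classical
  have e1 : tp (AC s P Q Ψ d n hnd p C) (vAC s Ψ q) α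
      = tp (Zt P Ψ d n hnd p) (tupSum (sysv Ψ)) α
        * tp ((C ×ˢ tuples s (Finset.Icc 1 (Q : ℤ))).filter fun cx => cx.2 ∈ Xvec Q s p cx.1)
            (fun cx => tupSum (powv k q) cx.2) α := by
    rw [tp_mul]; rfl
  rw [e1]
  congr 1
  unfold tp
  rw [sum_filter, sum_product]
  refine sum_congr rfl fun c hc => ?_
  -- `∑_{x ∈ tuples, x ∈ Xvec c} E(tupSum x) = tp (Xvec c) = ∏ g(c_i)`
  have hsub : Xvec Q s p c ⊆ tuples s (Finset.Icc 1 (Q : ℤ)) := by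
    intro x hx
    rw [Xvec, Fintype.mem_piFinset] at hx
    rw [mem_tuples]; intro i
    have := hx i; rw [Xc, mem_filter] at this; exact this.1
  simp only
  rw [← sum_filter, Finset.filter_mem_eq_inter, (inter_eq_right.2 hsub)]
  have hh := prod_tp_eq (n := k) (m := s) (fun i => Xc Q p (c i)) (fun _ => powv k q) α
  unfold tp at hh
  exact hh.symm

/-- **Pointwise Cauchy–Schwarz + AM–GM**:
`|F̃ ∑_{c∈C} G_c|² ≤ |F̃|² |C| ∑_{c∈C} (1/s) ∑_i |g(·;c_i)|^{2s}`. [cite: Ford2002, proof of Lemma 3.2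
("|U(α;w)|² ≤ |ℬ_s(w)| ∑ |g(α;c_1)⋯g(α;c_s)|² ≤ (d!/s) p^{s−d} ∑ ∑ |g(α;c_i)|^{2s}")] -/
theorem pointwise_bound (hs : 1 ≤ s) (C : Finset (Fin s → ℤ)) (α : Fin k → ℝ) :
    ‖tp (AC s P Q Ψ d n hnd p C) (vAC s Ψ q) α‖ ^ 2
      ≤ absFt P Ψ d n hnd p α ^ 2 * (C.card * ∑ c ∈ C, (∑ i, absg Q q p (c i) α ^ (2 * s)) / s) := by
  rw [tp_AC s P Q Ψ q d n hnd p C, norm_mul, mul_pow]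
  refine mul_le_mul_of_nonneg_left ?_ (by positivity)
  -- `‖∑ G_c‖² ≤ (∑ ‖G_c‖)² ≤ |C| ∑ ‖G_c‖²`
  have h1 : ‖∑ c ∈ C, ∏ i, tp (Xc Q p (c i)) (powv k q) α‖ ^ 2 ≤ (∑ c ∈ C, ‖∏ i, tp (Xc Q p (c i)) (powv k q) α‖) ^ 2 :=
    pow_le_pow_left₀ (norm_nonneg _) (norm_sum_le _ _) 2
  have h2 := sq_sum_le_card_mul_sum_sq (s := C) (f := fun c => ‖∏ i, tp (Xc Q p (c i)) (powv k q) α‖)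
  refine h1.trans (h2.trans ?_)
  refine mul_le_mul_of_nonneg_left (sum_le_sum fun c _ => ?_) (by positivity)
  -- `‖∏ g(c_i)‖² = ∏ ‖g(c_i)‖² ≤ (1/s) ∑ ‖g(c_i)‖^{2s}`
  rw [Complex.norm_prod, ← prod_pow]
  have h3 := prod_le_sum_pow_div hs (fun i => ‖tp (Xc Q p (c i)) (powv k q) α‖ ^ 2) (fun i => by positivity)
  refine h3.trans (le_of_eq ?_)
  simp only [absg, ← pow_mul, mul_comm 2 s]

/-- **The class count**: `#{(a,a') ∈ A_C² : v a = v a'} ≤ |C| (1/s) ∑_{c∈C} ∑_i S₄(c_i)`.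
[cite: Ford2002, proof of Lemma 3.2 (the display before (3.4))] -/
theorem card_AC_pairs_le (hs : 1 ≤ s) (C : Finset (Fin s → ℤ)) :
    ((((AC s P Q Ψ d n hnd p C) ×ˢ (AC s P Q Ψ d n hnd p C)).filter
        fun aa => vAC s Ψ q aa.1 = vAC s Ψ q aa.2).card : ℝ)
      ≤ C.card * ((∑ c ∈ C, ∑ i, (S4 s P Q Ψ q d n hnd p (c i) : ℝ)) / s) := by
  have h := integral_norm_sq_tp (n := k) (AC s P Q Ψ d n hnd p C) (vAC s Ψ q)
  rw [← h]
  have hpt := pointwise_bound s P Q Ψ q d n hnd p hs C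
  -- integrate the pointwise bound
  have hint : ∀ c, IntegrableOn (fun α => absFt P Ψ d n hnd p α ^ 2 * absg Q q p c α ^ (2 * s)) (box k) := by
    intro c
    refine integrableOn_box_of_continuous_real ?_
    exact ((continuous_tp _ _).norm.pow _).mul ((continuous_tp _ _).norm.pow _)
  calc ∫ α in box k, ‖tp (AC s P Q Ψ d n hnd p C) (vAC s Ψ q) α‖ ^ 2
      ≤ ∫ α in box k, absFt P Ψ d n hnd p α ^ 2 * (C.card * ∑ c ∈ C, (∑ i, absg Q q p (c i) α ^ (2 * s)) / s) := by
        refine setIntegral_mono_on ?_ ?_ (measurableSet_box k) (fun α _ => hpt α)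
        · exact integrableOn_box_of_continuous_real ((continuous_tp _ _).norm.pow _)
        · refine integrableOn_box_of_continuous_real ?_
          refine ((continuous_tp _ _).norm.pow _).mul (continuous_const.mul (continuous_finsetSum _ fun c _ => ?_))
          exact (continuous_finsetSum _ fun i _ => (continuous_tp _ _).norm.pow _).div_const _
    _ = C.card * ((∑ c ∈ C, ∑ i, ∫ α in box k, absFt P Ψ d n hnd p α ^ 2 * absg Q q p (c i) α ^ (2 * s)) / s) := by
        have e : ∀ α, absFt P Ψ d n hnd p α ^ 2 * (C.card * ∑ c ∈ C, (∑ i, absg Q q p (c i) α ^ (2 * s)) / s)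
            = (C.card : ℝ) / s * ∑ c ∈ C, ∑ i, absFt P Ψ d n hnd p α ^ 2 * absg Q q p (c i) α ^ (2 * s) := by
          intro α
          simp only [Finset.mul_sum, Finset.sum_div]
          exact sum_congr rfl fun c _ => sum_congr rfl fun i _ => by ring
        simp_rw [e]
        rw [integral_const_mul, integral_finsetSum _ (fun c _ => ?_)]
        · simp_rw [integral_finsetSum _ (fun i _ => hint _)]
          field_simp
        · exact integrable_finsetSum _ fun i _ => hint _
    _ = C.card * ((∑ c ∈ C, ∑ i, (S4 s P Q Ψ q d n hnd p (c i) : ℝ)) / s) := by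
        simp_rw [← S4_eq_integral]

/-- The residue vector `x mod p`. [folklore] -/
def resv {s : ℕ} (x : Fin s → ℤ) : Fin s → ℤ := fun i => x i % p

/-- The power sums (mod `p`) of the residues: the class label `w(x)`. [folklore] -/
def wOf (d : ℕ) {s : ℕ} (x : Fin s → ℤ) : Fin d → ℤ := fun j => (∑ i, resv p x i ^ (j.val + 1)) % p

omit Ψ q n hnd in
/-- Auxiliary step (elementary consequence of the standing hypotheses). [folklore] -/
theorem resv_mem (hp0 : 0 < p) {s : ℕ} (x : Fin s → ℤ) (i : Fin s) : resv p x i ∈ Finset.Ico (0 : ℤ) p := by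
  have hp' : (0 : ℤ) < p := by exact_mod_cast hp0
  rw [Finset.mem_Ico]; exact ⟨Int.emod_nonneg _ hp'.ne', Int.emod_lt_of_pos _ hp'⟩

omit Ψ q n hnd in
/-- Auxiliary step (elementary consequence of the standing hypotheses). [folklore] -/
theorem wOf_mem (hp0 : 0 < p) {s : ℕ} (x : Fin s → ℤ) : wOf p d x ∈ tuples d (Finset.Ico (0 : ℤ) p) := by
  have hp' : (0 : ℤ) < p := by exact_mod_cast hp0
  rw [mem_tuples]; intro j
  rw [Finset.mem_Ico]; exact ⟨Int.emod_nonneg _ hp'.ne', Int.emod_lt_of_pos _ hp'⟩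

omit Ψ q n hnd in
/-- `resv x ∈ ℬ(w(x))`. [folklore] -/
theorem resv_mem_Bclass (hp0 : 0 < p) {e : ℕ} (x : Fin (d + e) → ℤ) : resv p x ∈ Bclass p d e (wOf p d x) := by
  rw [mem_Bclass]
  exact ⟨fun i => resv_mem p hp0 x i, fun j => (Int.mod_modEq _ _).symm⟩

omit Ψ q n hnd in
/-- `x ∈ Xvec (resv x)` for `x ∈ [1,Q]^s`. [folklore] -/
theorem mem_Xvec_resv {s : ℕ} {x : Fin s → ℤ} (hx : x ∈ tuples s (Finset.Icc 1 (Q : ℤ))) : x ∈ Xvec Q s p (resv p x) := by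
  rw [Xvec, Fintype.mem_piFinset]; intro i
  rw [Xc, mem_filter]
  exact ⟨mem_tuples.1 hx i, (Int.mod_modEq (x i) p).dvd⟩

/-- **The key consequence of the type**: for a solution of (3.1) with `Ψ` of type `(d,T)`, the power
sums `∑ x_i^j = ∑ y_i^j` agree for `j ≤ d`. [cite: Ford2002, proof of Lemma 3.2 ("Since Ψ is of type
(d,T), for any solution of (3.1) we have ∑ (x_i^j − y_i^j) = 0 (1 ≤ j ≤ d)")] -/
theorem powerSum_eq_of_mem_Sol {T m : ℕ} (hΨ : IsType Ψ d T m) (hq : q ≠ 0) (hdk : d ≤ k)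
    {a} (ha : a ∈ Sol s P Q Ψ q) (j : ℕ) (hj : j < d) :
    (∑ i, a.1.2 i ^ (j + 1) : ℤ) = ∑ i, a.2.2 i ^ (j + 1) := by
  rw [mem_Sol] at ha
  have h := congrFun ha.2 ⟨j, by omega⟩
  simp only [Kfreq, Pi.add_apply] at h
  have hz : ∀ z : Fin k → ℤ, tupSum (sysv Ψ) z ⟨j, by omega⟩ = 0 := by
    intro z
    simp only [tupSum, Finset.sum_apply, sysv]
    rw [hΨ.zero ⟨j, by omega⟩ (by simp; omega)]
    simp
  rw [hz, hz, zero_add, zero_add, tupSum_powv, tupSum_powv] at h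
  have := mul_left_cancel₀ (pow_ne_zero _ hq) h
  simpa [psv] using this

/-- Every solution counted by `S₃(p)` is a tagged pair of `A_{ℬ(w)}` for `w = w(x)`. [folklore] -/
theorem tag_mem {T m : ℕ} (hΨ : IsType Ψ d T m) (hq : q ≠ 0) (hp0 : 0 < p) {e : ℕ} (hse : s = d + e)
    {a} (ha : a ∈ Sol3 s P Q Ψ q d n hnd p) :
    ((a.1.1, (resv p a.1.2, a.1.2)), (a.2.1, (resv p a.2.2, a.2.2)))
      ∈ ((AC s P Q Ψ d n hnd p (hse ▸ Bclass p d e (wOf p d (hse ▸ a.1.2 : Fin (d + e) → ℤ)) : Finset (Fin s → ℤ))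
          ×ˢ AC s P Q Ψ d n hnd p (hse ▸ Bclass p d e (wOf p d (hse ▸ a.1.2 : Fin (d + e) → ℤ)) : Finset (Fin s → ℤ))).filter
        fun aa => vAC s Ψ q aa.1 = vAC s Ψ q aa.2) := by
  subst hse
  rw [Sol3, mem_filter, mem_Sol] at ha
  obtain ⟨⟨⟨ha1, ha2⟩, heq⟩, hj1, hj2⟩ := ha
  rw [mem_KI] at ha1 ha2
  have hdk : d ≤ k := by omega
  have hpow := fun j hj => powerSum_eq_of_mem_Sol (d + e) P Q Ψ q d hΨ hq hdk
    (a := a) (by rw [mem_Sol, mem_KI, mem_KI]; exact ⟨⟨ha1, ha2⟩, heq⟩) j hj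
  rw [mem_filter, mem_product]
  refine ⟨⟨?_, ?_⟩, heq⟩
  · rw [AC, mem_product, mem_filter, mem_product]
    refine ⟨by rw [Zt, mem_filter, mem_tuples]; exact ⟨ha1.1, hj1⟩, ⟨?_, mem_tuples.2 ha1.2⟩, mem_Xvec_resv Q p (mem_tuples.2 ha1.2)⟩
    exact resv_mem_Bclass d p hp0 _
  · rw [AC, mem_product, mem_filter, mem_product]
    refine ⟨by rw [Zt, mem_filter, mem_tuples]; exact ⟨ha2.1, hj2⟩, ⟨?_, mem_tuples.2 ha2.2⟩, mem_Xvec_resv Q p (mem_tuples.2 ha2.2)⟩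
    -- `resv y ∈ ℬ(w(x))`: power sums of residues of `y` ≡ those of `y` = those of `x` ≡ those of residues of `x`
    rw [mem_Bclass]
    refine ⟨fun i => resv_mem p hp0 _ i, fun j => ?_⟩
    have h1 : (∑ i, resv p a.2.2 i ^ (j.val + 1) : ℤ) ≡ ∑ i, a.2.2 i ^ (j.val + 1) [ZMOD p] :=
      Int.ModEq.sum fun i _ => (Int.mod_modEq _ _).pow _
    have h2 : (∑ i, resv p a.1.2 i ^ (j.val + 1) : ℤ) ≡ ∑ i, a.1.2 i ^ (j.val + 1) [ZMOD p] :=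
      Int.ModEq.sum fun i _ => (Int.mod_modEq _ _).pow _
    have h3 := hpow j.val j.isLt
    have h4 : (∑ i, resv p a.1.2 i ^ (j.val + 1) : ℤ) ≡ wOf p d a.1.2 j [ZMOD p] := (Int.mod_modEq _ _).symm
    calc (∑ i, resv p a.2.2 i ^ (j.val + 1) : ℤ) ≡ ∑ i, a.2.2 i ^ (j.val + 1) [ZMOD p] := h1
      _ = ∑ i, a.1.2 i ^ (j.val + 1) := h3.symm
      _ ≡ ∑ i, resv p a.1.2 i ^ (j.val + 1) [ZMOD p] := h2.symm
      _ ≡ wOf p d a.1.2 j [ZMOD p] := h4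

/-- The classes `ℬ(w)`, `w ∈ [0,p)^d`, are pairwise disjoint; hence `∑_w |ℬ(w)| ≤ p^{d+e}`. [folklore] -/
theorem sum_card_Bclass_le (d e : ℕ) :
    ∑ w ∈ tuples d (Finset.Ico (0 : ℤ) p), (Bclass p d e w).card ≤ p ^ (d + e) := by
  classical
  have hdisj : Set.PairwiseDisjoint (↑(tuples d (Finset.Ico (0 : ℤ) p)) : Set (Fin d → ℤ)) (Bclass p d e) := by
    intro w hw w' hw' hne
    rw [Function.onFun, disjoint_left]
    intro c hc hc'
    apply hne
    rw [mem_Bclass] at hc hc'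
    funext j
    have h1 := (hc.2 j).symm.trans (hc'.2 j)
    rw [mem_coe, mem_tuples] at hw hw'
    have hwj := hw j; have hw'j := hw' j
    rw [Finset.mem_Ico] at hwj hw'j
    have := Int.ModEq.eq h1  -- w j % p = w' j % p
    rw [Int.emod_eq_of_lt hwj.1 hwj.2, Int.emod_eq_of_lt hw'j.1 hw'j.2] at this
    exact this
  rw [← card_biUnion hdisj]
  calc ((tuples d (Finset.Ico (0 : ℤ) p)).biUnion (Bclass p d e)).card
      ≤ (tuples (d + e) (Finset.Ico (0 : ℤ) p)).card := by
        refine card_le_card fun c hc => ?_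
        rw [mem_biUnion] at hc; obtain ⟨w, -, hc⟩ := hc
        rw [Bclass, mem_filter] at hc; exact hc.1
    _ = p ^ (d + e) := by rw [card_tuples]; simp

/-- **(3.4)**: `S₃(p) ≤ d! p^{2s−d} max_c S₄(c,p)` (`s = d + e`). [cite: Ford2002, (3.4)] -/
theorem card_Sol3_le [hpr : Fact p.Prime] {e : ℕ} (hse : s = d + e) (hdp : d < p) (hs : 1 ≤ s)
    {T m : ℕ} (hΨ : IsType Ψ d T m) (hq : q ≠ 0)
    {M : ℕ} (hM : ∀ c ∈ Finset.Ico (0 : ℤ) p, S4 s P Q Ψ q d n hnd p c ≤ M) :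
    (Sol3 s P Q Ψ q d n hnd p).card ≤ d.factorial * p ^ e * (p ^ s * M) := by
  classical
  subst hse
  have hp0 : 0 < p := hpr.out.pos
  set Wall := tuples d (Finset.Ico (0 : ℤ) p) with hWall
  -- fibre decomposition over `w(x)`
  have hfib : (Sol3 (d + e) P Q Ψ q d n hnd p).card
      = ∑ w ∈ Wall, ((Sol3 (d + e) P Q Ψ q d n hnd p).filter fun a => wOf p d a.1.2 = w).card :=
    card_eq_sum_card_fiberwise fun a _ => wOf_mem d p hp0 _
  -- each fibre injects into the tagged pairs of `A_{ℬ(w)}`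
  have hfib_le : ∀ w ∈ Wall, (((Sol3 (d + e) P Q Ψ q d n hnd p).filter fun a => wOf p d a.1.2 = w).card : ℝ)
      ≤ (Bclass p d e w).card * ((∑ c ∈ Bclass p d e w, ∑ i, (S4 (d + e) P Q Ψ q d n hnd p (c i) : ℝ)) / (d + e : ℕ)) := by
    intro w _
    refine le_trans ?_ (card_AC_pairs_le (d + e) P Q Ψ q d n hnd p hs (Bclass p d e w))
    have hinj := card_le_card_of_injOn
      (s := (Sol3 (d + e) P Q Ψ q d n hnd p).filter fun a => wOf p d a.1.2 = w)
      (t := ((AC (d + e) P Q Ψ d n hnd p (Bclass p d e w) ×ˢ AC (d + e) P Q Ψ d n hnd p (Bclass p d e w)).filter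
        fun aa => vAC (d + e) Ψ q aa.1 = vAC (d + e) Ψ q aa.2))
      (fun a => ((a.1.1, (resv p a.1.2, a.1.2)), (a.2.1, (resv p a.2.2, a.2.2)))) ?_ ?_
    · exact_mod_cast hinj
    · intro a ha
      rw [mem_coe, mem_filter] at ha
      have := tag_mem (d + e) P Q Ψ q d n hnd p hΨ hq hp0 rfl ha.1
      rw [← ha.2]; exact this
    · intro a _ b _ hab
      simp only [Prod.mk.injEq] at hab
      exact Prod.ext (Prod.ext hab.1.1 hab.1.2.2) (Prod.ext hab.2.1 hab.2.2.2)
  -- bound the inner sums by `M`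
  have hMc : ∀ w ∈ Wall, ∀ c ∈ Bclass p d e w, ∑ i, (S4 (d + e) P Q Ψ q d n hnd p (c i) : ℝ) ≤ (d + e : ℕ) * M := by
    intro w _ c hc
    rw [mem_Bclass] at hc
    calc ∑ i, (S4 (d + e) P Q Ψ q d n hnd p (c i) : ℝ) ≤ ∑ _i : Fin (d + e), (M : ℝ) :=
          sum_le_sum fun i _ => by exact_mod_cast hM _ (hc.1 i)
      _ = (d + e : ℕ) * M := by rw [sum_const, card_univ, Fintype.card_fin, nsmul_eq_mul]
  have hB := fun w => card_Bclass_le (e := e) hdp w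
  have hsR : (0 : ℝ) < (d + e : ℕ) := by exact_mod_cast hs
  -- assemble in `ℝ`
  have key : ((Sol3 (d + e) P Q Ψ q d n hnd p).card : ℝ)
      ≤ d.factorial * p ^ e * M * ∑ w ∈ Wall, ((Bclass p d e w).card : ℝ) := by
    rw [hfib]; push_cast
    rw [Finset.mul_sum]
    refine sum_le_sum fun w hw => ?_
    refine (hfib_le w hw).trans ?_
    have h1 : (∑ c ∈ Bclass p d e w, ∑ i, (S4 (d + e) P Q Ψ q d n hnd p (c i) : ℝ)) / (d + e : ℕ)
        ≤ (Bclass p d e w).card * M := by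
      rw [div_le_iff₀ hsR]
      calc ∑ c ∈ Bclass p d e w, ∑ i, (S4 (d + e) P Q Ψ q d n hnd p (c i) : ℝ)
          ≤ ∑ _c ∈ Bclass p d e w, ((d + e : ℕ) : ℝ) * M := sum_le_sum (hMc w hw)
        _ = (Bclass p d e w).card * M * (d + e : ℕ) := by rw [sum_const, nsmul_eq_mul]; ring
    have h2 : ((Bclass p d e w).card : ℝ) ≤ d.factorial * p ^ e := by exact_mod_cast hB w
    have h0 : (0 : ℝ) ≤ (Bclass p d e w).card := by positivity
    calc ((Bclass p d e w).card : ℝ) * ((∑ c ∈ Bclass p d e w, ∑ i, (S4 (d + e) P Q Ψ q d n hnd p (c i) : ℝ)) / (d + e : ℕ))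
        ≤ (Bclass p d e w).card * ((Bclass p d e w).card * M) := mul_le_mul_of_nonneg_left h1 h0
      _ ≤ (Bclass p d e w).card * ((d.factorial * p ^ e) * M) := by
          refine mul_le_mul_of_nonneg_left (mul_le_mul_of_nonneg_right h2 (by positivity)) h0
      _ = d.factorial * p ^ e * M * (Bclass p d e w).card := by ring
  have hsum := sum_card_Bclass_le p d e
  have hsumR : (∑ w ∈ Wall, ((Bclass p d e w).card : ℝ)) ≤ (p : ℝ) ^ (d + e) := by exact_mod_cast hsum
  have : ((Sol3 (d + e) P Q Ψ q d n hnd p).card : ℝ) ≤ d.factorial * p ^ e * (p ^ (d + e) * M) := by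
    refine key.trans ?_
    have : 0 ≤ (d.factorial : ℝ) * p ^ e * M := by positivity
    nlinarith
  exact_mod_cast this

end StepD

end FordVK
end Literature.NumberTheory.LFunctions
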